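import Summits.Ventures.PercRepro.ExploreTree
import Summits.Ventures.PercRepro.DFSTreeA

/-!
# The depth-first exploration of a cluster as a decision tree (Gladkov, Algorithm 2) — the tree

Continuation of `DFSTreeA.lean` (split for the ≤ 400-line lint; proofs byte-identical): the section «The tree» —
`edgesAtV`, `dfs`, `dfsStop`, `stopEvent`, `allS_dfs`, `proper_dfs`.
-/

namespace PercRepro

namespace MultiGraph

variable {V E : Type*} {G : MultiGraph V E}

/-! ### The tree -/

section Tree

variable [DecidableEq V] [DecidableEq E] (G)

/-- The unqueried edges at the vertex `w`. -/
def edgesAtV (U : Finset E) (w : V) : Finset E := U.filter fun e => G.fst e = w ∨ G.snd e = w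

/-- The other endpoint of an edge at `w`. -/
def other (e : E) (w : V) : V := if G.fst e = w then G.snd e else G.fst e

/-- **The DFS decision tree** with target set `T`: query an unqueried edge at `top` (into `S`);
if it is open and leads to a target, stop; if it leads to a new vertex, push it; otherwise
continue at `top`.  With no unqueried edge at `top`, pop (`top` is fully explored); with an
empty stack, stop. -/
noncomputable def dfs (T : Finset V) : Finset E → V → List (E × V) → Finset V → DTree E
  | U, top, L, Q =>
    if h : (G.edgesAtV U top).Nonempty then
      DTree.node h.choose true fun b _ =>
        if b then
          if G.other h.choose top ∈ T then DTree.leaf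
          else if G.other h.choose top = top ∨ G.other h.choose top ∈ L.map Prod.snd ∨
              G.other h.choose top ∈ Q then
            dfs T (U.erase h.choose) top L Q
          else dfs T (U.erase h.choose) (G.other h.choose top) ((h.choose, top) :: L) Q
        else dfs T (U.erase h.choose) top L Q
    else
      match L with
      | [] => DTree.leaf
      | (_, w) :: L' => dfs T U w L' (insert top Q)
termination_by U _ L _ => (U.card, L.length)
decreasing_by
  all_goals simp_wf
  all_goals first
    | exact Prod.Lex.left _ _ (Finset.card_erase_lt_of_mem (Finset.mem_of_mem_filter _ h.choose_spec))
    | exact Prod.Lex.right _ (Nat.lt_succ_self _)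

/-- **The stop result of the DFS** on the first configuration: `some u` if the tree stops
through an open edge to the target `u`, `none` if the cluster is exhausted (the decisions are
those of `dfs`). -/
noncomputable def dfsStop (T : Finset V) :
    Finset E → V → List (E × V) → Finset V → Config E → Option V
  | U, top, L, Q, ω =>
    if h : (G.edgesAtV U top).Nonempty then
      if ω h.choose then
        if G.other h.choose top ∈ T then some (G.other h.choose top)
        else if G.other h.choose top = top ∨ G.other h.choose top ∈ L.map Prod.snd ∨
            G.other h.choose top ∈ Q then
          dfsStop T (U.erase h.choose) top L Q ω
        else dfsStop T (U.erase h.choose) (G.other h.choose top) ((h.choose, top) :: L) Q ω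
      else dfsStop T (U.erase h.choose) top L Q ω
    else
      match L with
      | [] => none
      | (_, w) :: L' => dfsStop T U w L' (insert top Q) ω
termination_by U _ L _ _ => (U.card, L.length)
decreasing_by
  all_goals simp_wf
  all_goals first
    | exact Prod.Lex.left _ _ (Finset.card_erase_lt_of_mem (Finset.mem_of_mem_filter _ h.choose_spec))
    | exact Prod.Lex.right _ (Nat.lt_succ_self _)

/-- The event «the DFS started in the state `(U, top, L, Q)` stops at `u`». -/
def stopEvent (T : Finset V) (U : Finset E) (top : V) (L : List (E × V)) (Q : Finset V) (u : V) :
    Set (Config E) :=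
  {ω | G.dfsStop T U top L Q ω = some u}

variable {G}

/-- `Good t Qs v`: the tree `t`, reached with the queried set `Qs` and revealed states `v`,
decides `reachEvent a T` and every stop event of the DFS started in the reference state
`(U₀, top₀, L₀, Q₀)`, and every configuration of the cylinder ends in a `LeafState` for the
queried set of its run and its stop result. -/
def Good (T : Finset V) (a : V) (U₀ : Finset E) (top₀ : V) (L₀ : List (E × V)) (Q₀ : Finset V)
    (t : DTree E) (Qs : Set E) (v : E → Bool) : Prop :=
  DTree.Decides t Qs v (G.reachEvent a T) ∧
    (∀ u, DTree.Decides t Qs v (G.stopEvent T U₀ top₀ L₀ Q₀ u)) ∧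
    ∀ ω ω' : Config E, (∀ e ∈ Qs, ω e = v e) →
      G.LeafState T a ω (Qs ∪ DTree.run t ω ω') (G.dfsStop T U₀ top₀ L₀ Q₀ ω)

/-- A leaf is good when the cylinder decides the events and every configuration of it is in a
leaf state for `Qs`. -/
theorem good_leaf {T : Finset V} {a : V} {U₀ : Finset E} {top₀ : V} {L₀ : List (E × V)}
    {Q₀ : Finset V} {Qs : Set E} {v : E → Bool}
    (hdet : DeterminedOn (G.reachEvent a T) Qs v)
    (hstop : ∀ u, DeterminedOn (G.stopEvent T U₀ top₀ L₀ Q₀ u) Qs v)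
    (hleaf : ∀ ω : Config E, (∀ e ∈ Qs, ω e = v e) →
      G.LeafState T a ω Qs (G.dfsStop T U₀ top₀ L₀ Q₀ ω)) :
    G.Good T a U₀ top₀ L₀ Q₀ DTree.leaf Qs v := by
  refine ⟨hdet, hstop, fun ω ω' hω => ?_⟩
  simp only [DTree.run, Set.union_empty]
  exact hleaf ω hω

/-- A node sending its edge to `S` is good when all its continuations are. -/
theorem good_node {T : Finset V} {a : V} {U₀ : Finset E} {top₀ : V} {L₀ : List (E × V)}
    {Q₀ : Finset V} {Qs : Set E} {v : E → Bool} {e : E} {next : Bool → Bool → DTree E}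
    (h : ∀ b b', G.Good T a U₀ top₀ L₀ Q₀ (next b b') (insert e Qs) (Function.update v e b)) :
    G.Good T a U₀ top₀ L₀ Q₀ (DTree.node e true next) Qs v := by
  refine ⟨fun b b' => (h b b').1, fun u b b' => (h b b').2.1 u, fun ω ω' hω => ?_⟩
  have hω' : ∀ e' ∈ insert e Qs, ω e' = Function.update v e (ω e) e' := by
    intro e' he'
    by_cases hee : e' = e
    · rw [hee, Function.update_self]
    · rw [Function.update_of_ne hee]
      exact hω e' (Set.mem_insert_iff.mp he' |>.resolve_left hee)
  have := (h (ω e) (ω' e)).2.2 ω ω' hω'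
  have hset : insert e Qs ∪ DTree.run (next (ω e) (ω' e)) ω ω' =
      Qs ∪ DTree.run (DTree.node e true next) ω ω' := by
    simp only [DTree.run, if_true]
    ext x; simp only [Set.mem_union, Set.mem_insert_iff, Set.mem_singleton_iff]; tauto
  rw [hset] at this
  exact this

omit [DecidableEq E] in
/-- An edge of `edgesAtV U w` is an unqueried edge at `w`. -/
theorem mem_edgesAtV {U : Finset E} {w : V} {e : E} :
    e ∈ G.edgesAtV U w ↔ e ∈ U ∧ (G.fst e = w ∨ G.snd e = w) := by
  simp [edgesAtV]

omit [DecidableEq E] in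
/-- The endpoints of an edge at `w` are `w` and `other e w`. -/
theorem ends_other {e : E} {w : V} (h : G.fst e = w ∨ G.snd e = w) :
    (G.fst e = w ∧ G.snd e = G.other e w) ∨ (G.fst e = G.other e w ∧ G.snd e = w) := by
  unfold other
  by_cases hf : G.fst e = w
  · left; exact ⟨hf, by rw [if_pos hf]⟩
  · right
    rcases h with h | h
    · exact absurd h hf
    · exact ⟨by rw [if_neg hf], h⟩


/-- Every node of the DFS tree sends its edge to `S`. -/
theorem allS_dfs (T : Finset V) : ∀ (U : Finset E) (L : List (E × V)) (top : V) (Q : Finset V),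
    DTree.AllS (G.dfs T U top L Q) := by
  intro U
  induction U using Finset.strongInduction with
  | H U ih =>
    intro L
    induction L with
    | nil =>
      intro top Q
      by_cases h : (G.edgesAtV U top).Nonempty
      · rw [dfs, dif_pos h]
        refine ⟨rfl, fun b _ => ?_⟩
        have hsub := Finset.erase_ssubset (mem_edgesAtV.mp h.choose_spec).1
        cases b
        · exact ih _ hsub _ _ _
        · simp only [if_true]
          split_ifs
          · trivial
          · exact ih _ hsub _ _ _
          · exact ih _ hsub _ _ _
      · rw [dfs, dif_neg h]
        trivial
    | cons y L ihL =>
      intro top Q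
      obtain ⟨e, w⟩ := y
      by_cases h : (G.edgesAtV U top).Nonempty
      · rw [dfs, dif_pos h]
        refine ⟨rfl, fun b _ => ?_⟩
        have hsub := Finset.erase_ssubset (mem_edgesAtV.mp h.choose_spec).1
        cases b
        · exact ih _ hsub _ _ _
        · simp only [if_true]
          split_ifs
          · trivial
          · exact ih _ hsub _ _ _
          · exact ih _ hsub _ _ _
      · rw [dfs, dif_neg h]
        exact ihL w (insert top Q)

/-- The DFS tree is proper with respect to every queried set disjoint from `U`. -/
theorem proper_dfs (T : Finset V) : ∀ (U : Finset E) (L : List (E × V)) (top : V) (Q : Finset V)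
    (Qs : Set E), (∀ e ∈ U, e ∉ Qs) → DTree.Proper (G.dfs T U top L Q) Qs := by
  intro U
  induction U using Finset.strongInduction with
  | H U ih =>
    intro L
    induction L with
    | nil =>
      intro top Q Qs hQ
      by_cases h : (G.edgesAtV U top).Nonempty
      · rw [dfs, dif_pos h]
        have he : h.choose ∈ U := (mem_edgesAtV.mp h.choose_spec).1
        have hsub := Finset.erase_ssubset he
        have hQ' : ∀ e' ∈ U.erase h.choose, e' ∉ insert h.choose Qs := by
          intro e' he' hmem
          rcases Set.mem_insert_iff.mp hmem with h' | hmem'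
          · rw [h'] at he'
            exact Finset.notMem_erase _ U he'
          · exact hQ e' (Finset.mem_of_mem_erase he') hmem'
        refine ⟨hQ _ he, fun b b' => ?_⟩
        cases b
        · exact ih _ hsub _ _ _ _ hQ'
        · simp only [if_true]
          split_ifs
          · trivial
          · exact ih _ hsub _ _ _ _ hQ'
          · exact ih _ hsub _ _ _ _ hQ'
      · rw [dfs, dif_neg h]
        trivial
    | cons y L ihL =>
      intro top Q Qs hQ
      obtain ⟨e, w⟩ := y
      by_cases h : (G.edgesAtV U top).Nonempty
      · rw [dfs, dif_pos h]
        have he : h.choose ∈ U := (mem_edgesAtV.mp h.choose_spec).1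
        have hsub := Finset.erase_ssubset he
        have hQ' : ∀ e' ∈ U.erase h.choose, e' ∉ insert h.choose Qs := by
          intro e' he' hmem
          rcases Set.mem_insert_iff.mp hmem with h' | hmem'
          · rw [h'] at he'
            exact Finset.notMem_erase _ U he'
          · exact hQ e' (Finset.mem_of_mem_erase he') hmem'
        refine ⟨hQ _ he, fun b b' => ?_⟩
        cases b
        · exact ih _ hsub _ _ _ _ hQ'
        · simp only [if_true]
          split_ifs
          · trivial
          · exact ih _ hsub _ _ _ _ hQ'
          · exact ih _ hsub _ _ _ _ hQ'
      · rw [dfs, dif_neg h]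
        exact ihL w (insert top Q) Qs hQ


end Tree

end MultiGraph

end PercRepro
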